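import Literature.Topology.FourManifolds.CollarHeightFunction
import Literature.Topology.FourManifolds.OpenCollarExistence
import Literature.Analysis.Calculus.SmoothCutoff
import Mathlib.Analysis.Calculus.Deriv.Inv
import Mathlib.Analysis.Calculus.Deriv.Mul
import Mathlib.Analysis.Calculus.Deriv.Comp
import Mathlib.Analysis.SpecialFunctions.SmoothTransition
import HarnessLib

/-!
# Seam gluing of Morse functions, I: the one-variable profile

Helper file (lead c1, crux `ConvexBisection.AcyclicBisectionRigidity`, item
stmt-SmoothPoincare4-10507; serves the typed packaging step of the levers
`stub_seamPairDichotomy` / `stub_crossCancellation`: "glue adapted Morse functions on the two halves of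
a bisection to one Morse function on the closed manifold").

The glued manifold `M ∪_φ N` of the tree (`BoundaryGlueData`, `BoundaryGluingConstruction.lean`) is
assembled from the interiors and the seam `∂M × ℝ`, the collar of `M` occupying `∂M × [0, ∞)` and the
collar of `N` occupying `∂M × (-∞, 0]`; along the flow-out collar of an adapted Morse function `f`
(`MorseHeightCollar.lean`, `OpenCollarExistence.lean`) one has `1 - f (collar x s) = collarStretch a s`
for the height `a` of the flow-out.  To make the two Morse functions match SMOOTHLY across the seam we
post-compose `1 - f` with a smooth increasing reparametrisation `A_a` which inverts `collarStretch a`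
near `0` (`A_a (collarStretch a s) = s` for `0 ≤ s ≤ 1/15`) and is LINEAR away from the collar (so
that near the critical points the new function is an affine function of `f`).  This file is the
one-variable calculus of that reparametrisation:

* `heightProfile_le_one`, `exists_hasDerivAt_heightProfile_nonneg` — the tree's height profile
  (`CollarHeightFunction.lean`) is `≤ 1` and has a nonnegative derivative;
* `exists_seamReparam` — for `a > 0` a smooth `A : ℝ → ℝ` with positive derivative, `A u = u / (a - u)`
  for `u ≤ a/16` and `A u = 8u/(7a)` for `u ≥ 3a/32`;
* `exists_seamProfile` — for `a, b > 0` the reparametrisations `A = A_a`, `B = A_b` and the seam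
  profile `σ`, smooth with negative derivative, `σ t = 1 - B (collarStretch b t)` for `t ≥ 0` and
  `σ t = 1 + A (collarStretch a (-t))` for `t ≤ 0` (both equal `1 - t` for `|t| ≤ 1/15`).

Everything is proved; no definitions (the functions are produced existentially). [folklore]
-/

noncomputable section

open scoped Topology ContDiff
open Set Filter Literature.Topology.FourManifolds

-- the prescribed namespace `Summit.<P>.<Sub>.…` duplicates `SmoothPoincare4` (P = Sub)
set_option linter.dupNamespace false

namespace Summit.SmoothPoincare4.SmoothPoincare4.Theorems.AcyclicBisectionRigidity.SeamGluing

/-! ### The height profile: bounded by `1`, nondecreasing -/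

/-- The height profile is at most `1`. [folklore] -/
theorem heightProfile_le_one (t : ℝ) : heightProfile t ≤ 1 := by
  rcases le_or_gt (3 / 4 : ℝ) t with ht | ht
  · rw [heightProfile_of_ge ht]
  · have h0 : 0 ≤ heightStep t := Real.smoothTransition.nonneg _
    have h1 : heightStep t ≤ 1 := Real.smoothTransition.le_one _
    unfold heightProfile
    nlinarith [mul_nonneg (sub_nonneg.2 h1) (show (0 : ℝ) ≤ 1 - t by linarith)]

/-- The smooth step has a nonnegative derivative, vanishing on `t ≥ 3/4`. [folklore] -/
theorem hasDerivAt_heightStep (t : ℝ) :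
    HasDerivAt heightStep (deriv Real.smoothTransition (4 * (t - 2⁻¹)) * 4) t := by
  have h1 : HasDerivAt (fun t : ℝ => 4 * (t - 2⁻¹)) 4 t := by
    simpa using ((hasDerivAt_id t).sub_const (2⁻¹ : ℝ)).const_mul (4 : ℝ)
  have h2 : HasDerivAt Real.smoothTransition (deriv Real.smoothTransition (4 * (t - 2⁻¹)))
      (4 * (t - 2⁻¹)) :=
    (Literature.Analysis.Calculus.differentiable_smoothTransition _).hasDerivAt
  exact h2.comp t h1

/-- **The height profile has a nonnegative derivative** (`(1 - σ) + σ' (1 - t)` with `σ' ≥ 0`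
supported in `t ≤ 3/4`). [folklore] -/
theorem exists_hasDerivAt_heightProfile_nonneg (t : ℝ) :
    ∃ d, 0 ≤ d ∧ HasDerivAt heightProfile d t := by
  set s' : ℝ := deriv Real.smoothTransition (4 * (t - 2⁻¹)) * 4 with hs'
  have hstep := hasDerivAt_heightStep t
  have hs'0 : 0 ≤ s' := mul_nonneg Real.smoothTransition.monotone.deriv_nonneg (by norm_num)
  -- derivative of `(1 - σ t) * t + σ t`
  have hd : HasDerivAt heightProfile ((0 - s') * t + (1 - heightStep t) * 1 + s') t := by
    have h1 : HasDerivAt (fun t => 1 - heightStep t) (0 - s') t :=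
      (hasDerivAt_const t (1 : ℝ)).sub hstep
    exact (h1.mul (hasDerivAt_id t)).add hstep
  refine ⟨_, ?_, hd⟩
  have h0 : heightStep t ≤ 1 := Real.smoothTransition.le_one _
  rcases le_or_gt (3 / 4 : ℝ) t with ht | ht
  · -- `σ' = 0` there
    have hz : s' = 0 := by
      rw [hs', Literature.Analysis.Calculus.deriv_smoothTransition_of_one_le (by linarith), zero_mul]
    rw [hz]; nlinarith
  · nlinarith [mul_nonneg hs'0 (show (0 : ℝ) ≤ 1 - t by linarith)]

/-- On `t < 1/2` the height profile is the identity near `t`, so its derivative is `1`. [folklore] -/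
theorem hasDerivAt_heightProfile_of_lt {t : ℝ} (ht : t < 2⁻¹) : HasDerivAt heightProfile 1 t := by
  have h : heightProfile =ᶠ[𝓝 t] id := by
    filter_upwards [Iio_mem_nhds ht] with s hs
    exact heightProfile_of_le (le_of_lt hs)
  exact (hasDerivAt_id t).congr_of_eventuallyEq h

/-! ### The reparametrisation `A_a` -/

/-- **The seam reparametrisation.** For `a > 0` there is a smooth `A : ℝ → ℝ` with everywhere
positive derivative, equal to `u / (a - u)` (the inverse of `collarStretch a`) for `u ≤ a/16` and
to the linear function `8u/(7a)` for `u ≥ 3a/32`.  Construction: `A u = u / (a - c u)` with the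
capped identity `c u = (a/8) · heightProfile (8u/a)` (`= u` for `u ≤ a/16`, `= a/8` for
`u ≥ 3a/32`, `≤ a/8`, nondecreasing). [folklore] -/
theorem exists_seamReparam {a : ℝ} (ha : 0 < a) :
    ∃ A : ℝ → ℝ, ContDiff ℝ ∞ A ∧ (∀ u, ∃ d, 0 < d ∧ HasDerivAt A d u) ∧
      (∀ u, u ≤ a / 16 → A u = u / (a - u)) ∧ (∀ u, 3 * a / 32 ≤ u → A u = 8 * u / (7 * a)) := by
  set c : ℝ → ℝ := fun u => a / 8 * heightProfile (8 * u / a) with hc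
  have hc_le : ∀ u, c u ≤ a / 8 := fun u => by
    have := heightProfile_le_one (8 * u / a)
    simp only [hc]; nlinarith
  have hden : ∀ u, 0 < a - c u := fun u => by linarith [hc_le u]
  have hc_small : ∀ u, u ≤ a / 16 → c u = u := fun u hu => by
    have h : 8 * u / a ≤ 2⁻¹ := by
      rw [div_le_iff₀ ha]; linarith
    simp only [hc, heightProfile_of_le h]
    field_simp
  have hc_large : ∀ u, 3 * a / 32 ≤ u → c u = a / 8 := fun u hu => by
    have h : 3 / 4 ≤ 8 * u / a := by
      rw [le_div_iff₀ ha]; linarith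
    simp only [hc, heightProfile_of_ge h, mul_one]
  have hc_smooth : ContDiff ℝ ∞ c :=
    contDiff_const.mul (contDiff_heightProfile.comp ((contDiff_const.mul contDiff_id).div_const a))
  -- derivative of `c`: nonnegative, and `= 1` where `u < a/16`
  have hc_deriv : ∀ u, ∃ e, 0 ≤ e ∧ HasDerivAt c e u ∧ (u < 0 → e = 1) := by
    intro u
    have hlin : HasDerivAt (fun u : ℝ => 8 * u / a) (8 / a) u := by
      have := ((hasDerivAt_id u).const_mul (8 : ℝ)).div_const a
      simpa using this
    rcases lt_or_ge u 0 with hu | hu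
    · -- identity region
      have hlt : 8 * u / a < 2⁻¹ := by
        rw [div_lt_iff₀ ha]; nlinarith
      have h1 : HasDerivAt heightProfile 1 (8 * u / a) := hasDerivAt_heightProfile_of_lt hlt
      have h2 : HasDerivAt c (a / 8 * (1 * (8 / a))) u := (h1.comp u hlin).const_mul (a / 8)
      refine ⟨1, zero_le_one, ?_, fun _ => rfl⟩
      convert h2 using 1
      field_simp
    · obtain ⟨d, hd0, hd⟩ := exists_hasDerivAt_heightProfile_nonneg (8 * u / a)
      have h2 : HasDerivAt c (a / 8 * (d * (8 / a))) u := (hd.comp u hlin).const_mul (a / 8)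
      refine ⟨a / 8 * (d * (8 / a)), by positivity, h2, fun h => absurd hu (not_le.2 h)⟩
  refine ⟨fun u => u / (a - c u), ?_, ?_, ?_, ?_⟩
  · exact contDiff_id.div (contDiff_const.sub hc_smooth) fun u => (hden u).ne'
  · intro u
    obtain ⟨e, he0, he, he1⟩ := hc_deriv u
    have hD : HasDerivAt (fun u => a - c u) (0 - e) u := (hasDerivAt_const u a).sub he
    have hq := (hasDerivAt_id u).div hD (hden u).ne'
    refine ⟨_, ?_, hq⟩
    simp only [id_eq, one_mul, zero_sub, mul_neg, sub_neg_eq_add]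
    apply div_pos _ (pow_pos (hden u) 2)
    rcases lt_or_ge u 0 with hu | hu
    · rw [he1 hu, hc_small u (by linarith)]
      linarith
    · nlinarith [hden u, mul_nonneg hu he0]
  · intro u hu
    simp only [hc_small u hu]
  · intro u hu
    simp only [hc_large u hu]
    field_simp
    ring

/-! ### The stretching `collarStretch` -/

/-- The derivative of `collarStretch a` at `s ≠ -1` is `a / (1 + s)²` (positive for `a > 0`). [folklore] -/
theorem hasDerivAt_collarStretch (a : ℝ) {s : ℝ} (hs : 1 + s ≠ 0) :
    HasDerivAt (collarStretch a) (a / (1 + s) ^ 2) s := by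
  have h1 : HasDerivAt (fun s : ℝ => a * s) a s := by
    simpa using (hasDerivAt_id s).const_mul a
  have h2 : HasDerivAt (fun s : ℝ => 1 + s) 1 s := by
    simpa using (hasDerivAt_id s).const_add (1 : ℝ)
  have h : HasDerivAt (fun s : ℝ => a * s / (1 + s)) ((a * (1 + s) - a * s * 1) / (1 + s) ^ 2) s :=
    h1.div h2 hs
  have h' : HasDerivAt (collarStretch a) ((a * (1 + s) - a * s * 1) / (1 + s) ^ 2) s := h
  convert h' using 1
  field_simp
  ring

/-- `collarStretch a` is smooth at every `s > -1`. [folklore] -/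
theorem contDiffAt_collarStretch (a : ℝ) {s : ℝ} (hs : -1 < s) : ContDiffAt ℝ ∞ (collarStretch a) s :=
  (contDiffOn_collarStretch a).contDiffAt (Ioi_mem_nhds hs)

/-- For `0 ≤ s ≤ 1/15` the stretched parameter is at most `a/16` (`a > 0`). [folklore] -/
theorem collarStretch_le_of_le {a s : ℝ} (ha : 0 < a) (hs0 : 0 ≤ s) (hs : s ≤ 1 / 15) :
    collarStretch a s ≤ a / 16 := by
  rw [collarStretch, div_le_iff₀ (by linarith)]
  nlinarith

/-! ### The seam profile -/

/-- **The seam profile.** For `a, b > 0` there are the two reparametrisations `A = A_a`, `B = A_b`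
of `exists_seamReparam` and a smooth `σ : ℝ → ℝ` with everywhere NEGATIVE derivative such that
`σ t = 1 - B (collarStretch b t)` for `t ≥ 0` and `σ t = 1 + A (collarStretch a (-t))` for `t ≤ 0`
(near `0` both formulas read `1 - t`, which is how smoothness across `0` is proved).  In the model
gluing `M ∪_φ N` the function which is `1 - B (1 - f_M)` on `M` and `1 + A (1 - f_N)` on `N`
(for adapted Morse functions `f_M`, `f_N` with flow-out heights `b`, `a`) reads `σ (height)` on the
seam piece. [folklore] -/
theorem exists_seamProfile {a b : ℝ} (ha : 0 < a) (hb : 0 < b) :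
    ∃ (A B σ : ℝ → ℝ), ContDiff ℝ ∞ A ∧ ContDiff ℝ ∞ B ∧ ContDiff ℝ ∞ σ ∧
      (∀ u, ∃ d, 0 < d ∧ HasDerivAt A d u) ∧ (∀ u, ∃ d, 0 < d ∧ HasDerivAt B d u) ∧
      (∀ t, ∃ d, d < 0 ∧ HasDerivAt σ d t) ∧
      (∀ u, 3 * a / 32 ≤ u → A u = 8 * u / (7 * a)) ∧ (∀ u, 3 * b / 32 ≤ u → B u = 8 * u / (7 * b)) ∧
      (∀ t, 0 ≤ t → σ t = 1 - B (collarStretch b t)) ∧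
      (∀ t, t ≤ 0 → σ t = 1 + A (collarStretch a (-t))) := by
  obtain ⟨A, hAs, hAd, hA0, hA1⟩ := exists_seamReparam ha
  obtain ⟨B, hBs, hBd, hB0, hB1⟩ := exists_seamReparam hb
  set σ : ℝ → ℝ := fun t => if 0 ≤ t then 1 - B (collarStretch b t) else 1 + A (collarStretch a (-t))
    with hσ
  -- the two branches and the middle formula `1 - t`
  have hpos : ∀ t, 0 ≤ t → σ t = 1 - B (collarStretch b t) := fun t ht => by simp [hσ, ht]
  have hneg' : ∀ t, t < 0 → σ t = 1 + A (collarStretch a (-t)) := fun t ht => by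
    simp [hσ, not_le.2 ht]
  have hmidp : ∀ t, 0 ≤ t → t ≤ 1 / 15 → 1 - B (collarStretch b t) = 1 - t := fun t ht0 ht => by
    rw [hB0 _ (collarStretch_le_of_le hb ht0 ht), collarStretch_div_sub hb ht0]
  have hmidn : ∀ t, t ≤ 0 → -(1 / 15) ≤ t → 1 + A (collarStretch a (-t)) = 1 - t := fun t ht0 ht => by
    rw [hA0 _ (collarStretch_le_of_le ha (by linarith) (by linarith)),
      collarStretch_div_sub ha (by linarith)]
    ring
  have hneg : ∀ t, t ≤ 0 → σ t = 1 + A (collarStretch a (-t)) := fun t ht => by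
    rcases lt_or_eq_of_le ht with h | h
    · exact hneg' t h
    · subst h
      rw [hpos 0 le_rfl, hmidp 0 le_rfl (by norm_num), hmidn 0 le_rfl (by norm_num)]
  have hmid : ∀ t ∈ Ioo (-(1 / 15) : ℝ) (1 / 15), σ t = 1 - t := fun t ht => by
    rcases le_or_gt 0 t with h | h
    · rw [hpos t h, hmidp t h ht.2.le]
    · rw [hneg' t h, hmidn t h.le ht.1.le]
  -- eventual forms
  have hevp : ∀ t, 0 < t → σ =ᶠ[𝓝 t] fun t => 1 - B (collarStretch b t) := fun t ht => by
    filter_upwards [Ioi_mem_nhds ht] with s hs using hpos s (le_of_lt hs)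
  have hevn : ∀ t, t < 0 → σ =ᶠ[𝓝 t] fun t => 1 + A (collarStretch a (-t)) := fun t ht => by
    filter_upwards [Iio_mem_nhds ht] with s hs using hneg' s hs
  have hevm : ∀ t ∈ Ioo (-(1 / 15) : ℝ) (1 / 15), σ =ᶠ[𝓝 t] fun t => 1 - t := fun t ht => by
    filter_upwards [Ioo_mem_nhds ht.1 ht.2] with s hs using hmid s hs
  -- derivatives on the three regions
  have hderp : ∀ t, 0 < t → ∃ d, d < 0 ∧ HasDerivAt σ d t := fun t ht => by
    obtain ⟨e, he0, he⟩ := hBd (collarStretch b t)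
    have hcs := hasDerivAt_collarStretch b (s := t) (by linarith)
    have h : HasDerivAt (fun t => 1 - B (collarStretch b t)) (0 - e * (b / (1 + t) ^ 2)) t :=
      (hasDerivAt_const t (1 : ℝ)).sub (he.comp t hcs)
    refine ⟨_, ?_, h.congr_of_eventuallyEq (hevp t ht)⟩
    have : 0 < e * (b / (1 + t) ^ 2) := mul_pos he0 (div_pos hb (by positivity))
    linarith
  have hdern : ∀ t, t < 0 → ∃ d, d < 0 ∧ HasDerivAt σ d t := fun t ht => by
    obtain ⟨e, he0, he⟩ := hAd (collarStretch a (-t))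
    have hcs := hasDerivAt_collarStretch a (s := -t) (by linarith)
    have hneg1 : HasDerivAt (fun t : ℝ => -t) (-1) t := hasDerivAt_neg t
    have h : HasDerivAt (fun t => 1 + A (collarStretch a (-t))) (0 + e * (a / (1 + -t) ^ 2 * -1)) t :=
      (hasDerivAt_const t (1 : ℝ)).add (he.comp t (hcs.comp t hneg1))
    refine ⟨_, ?_, h.congr_of_eventuallyEq (hevn t ht)⟩
    have : 0 < e * (a / (1 + -t) ^ 2) := mul_pos he0 (div_pos ha (by nlinarith))
    nlinarith
  have hderm : ∀ t ∈ Ioo (-(1 / 15) : ℝ) (1 / 15), ∃ d, d < 0 ∧ HasDerivAt σ d t := fun t ht => by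
    refine ⟨-1, by norm_num, ?_⟩
    have h : HasDerivAt (fun t : ℝ => 1 - t) (0 - 1) t := (hasDerivAt_const t (1 : ℝ)).sub (hasDerivAt_id t)
    rw [zero_sub] at h
    exact h.congr_of_eventuallyEq (hevm t ht)
  -- smoothness on the three regions
  have hsmp : ∀ t, 0 < t → ContDiffAt ℝ ∞ σ t := fun t ht => by
    have h : ContDiffAt ℝ ∞ (fun t => 1 - B (collarStretch b t)) t :=
      contDiffAt_const.sub (hBs.contDiffAt.comp t (contDiffAt_collarStretch b (by linarith)))
    exact h.congr_of_eventuallyEq (hevp t ht)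
  have hsmn : ∀ t, t < 0 → ContDiffAt ℝ ∞ σ t := fun t ht => by
    have h1 : ContDiffAt ℝ ∞ (fun t : ℝ => collarStretch a (-t)) t :=
      (contDiffAt_collarStretch a (s := -t) (by linarith)).comp t contDiffAt_id.neg
    have h : ContDiffAt ℝ ∞ (fun t => 1 + A (collarStretch a (-t))) t :=
      contDiffAt_const.add (hAs.contDiffAt.comp t h1)
    exact h.congr_of_eventuallyEq (hevn t ht)
  have hsmm : ∀ t ∈ Ioo (-(1 / 15) : ℝ) (1 / 15), ContDiffAt ℝ ∞ σ t := fun t ht =>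
    (contDiffAt_const.sub contDiffAt_id).congr_of_eventuallyEq (hevm t ht)
  refine ⟨A, B, σ, hAs, hBs, ?_, hAd, hBd, ?_, hA1, hB1, hpos, hneg⟩
  · rw [contDiff_iff_contDiffAt]
    intro t
    rcases lt_trichotomy t 0 with ht | rfl | ht
    · exact hsmn t ht
    · exact hsmm 0 ⟨by norm_num, by norm_num⟩
    · exact hsmp t ht
  · intro t
    rcases lt_trichotomy t 0 with ht | rfl | ht
    · exact hdern t ht
    · exact hderm 0 ⟨by norm_num, by norm_num⟩
    · exact hderp t ht

end Summit.SmoothPoincare4.SmoothPoincare4.Theorems.AcyclicBisectionRigidity.SeamGluing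

end
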